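import Summits.Schanuel.Schanuel.Theorems.ZilberEacCurveGraphFibreSurface
import Summits.Schanuel.Schanuel.Theorems.ZilberEacParamSurfaceCase
import HarnessLib

/-!
# Arbitrary base branches, VIII: the CASE CERTIFICATE for graph fibres over an arbitrary plane
# curve — `{A(x₀, x₁) = 0, y₀ = R(x₀, x₁)}` satisfies the hypotheses of Mantova–Masser's case

HONEST FRAMING.  Cell `pub-schanuel` (Zilber's Exponential-Algebraic Closedness, case ladder;
host summit Schanuel), seat 2, gen 28.  For an irreducible `A ∈ ℂ[x₀, x₁]` and `R ∈ ℂ[x₀, x₁]`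
not divisible by `A` (a point of the curve `C = Z(A)` with `R ≠ 0`), the surface
`S(A; R) = {A(x₀, x₁) = 0, y₀ = R(x₀, x₁)}` of file VI is in Mantova–Masser's case
(dim-π-S-1-free) as soon as `C` is not a line of rational slope:
* **`vanishingIdeal_projAdd_curveGraphFibre`** — `I(π(S ∩ G²)) = (A)` (the torus part projects
  onto `{x ∈ C : R(x) ≠ 0}`; a polynomial vanishing there times `R` vanishes on `C = Z(A)`, so lies
  in `I(Z(A)) = (A)` by the Nullstellensatz, and `A ∤ R`);
* **`addProjDim_curveGraphFibre`** — `dim cl π(S ∩ G²) = dim ℂ[x₀, x₁]/(A) = 1`;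
* **`not_isRationalSlopeLine_curveGraphFibre`** — from witnesses: for every `m ∈ ℤ² ∖ 0` and `c`
  a point of `C` off the line `m₀x₀ + m₁x₁ = c`;
* **`mmCase_curveGraphFibre`** — the certificate `MMCaseDimPiOneFree (S(A; R))`.
File IX applies it to the genus-one example of file VII ("case ∧ dense").  [folklore algebraic
geometry]; nothing here is specific to Schanuel's conjecture (neither used nor implied);
Mantova–Masser's question (PLMS 2024 §1 p. 5) and EC(3,2) stay OPEN.
-/

noncomputable section

open Set Complex MvPolynomial
open Literature.NumberTheory.Transcendental Literature.ModelTheory.Zilber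
open Literature.ModelTheory.ExponentialFields

set_option linter.dupNamespace false

namespace Summit.Schanuel.Schanuel.Theorems

section Case

variable (A R : MvPolynomial (Fin 2) ℂ)

/-- The torus part of `S(A; R)` projects onto `{x : A(x) = 0, R(x) ≠ 0}`. -/
theorem projAdd_image_curveGraphFibre_inter_torusLocus :
    projAdd '' ({w : Fin 2 ⊕ Fin 2 → ℂ |
        MvPolynomial.eval ![w (Sum.inl 0), w (Sum.inl 1)] A = 0 ∧
        w (Sum.inr 0) = MvPolynomial.eval ![w (Sum.inl 0), w (Sum.inl 1)] R} ∩ torusLocus ℂ 2) =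
      {x : Fin 2 → ℂ | MvPolynomial.eval x A = 0 ∧ MvPolynomial.eval x R ≠ 0} := by
  ext x
  constructor
  · rintro ⟨w, ⟨⟨hA, hR⟩, htor⟩, rfl⟩
    have e : (![w (Sum.inl 0), w (Sum.inl 1)] : Fin 2 → ℂ) = projAdd w := by
      funext j; fin_cases j <;> rfl
    rw [e] at hA hR
    refine ⟨hA, ?_⟩
    rw [← hR]
    exact (mem_torusLocus_iff.1 htor) 0
  · rintro ⟨hA, hR⟩
    refine ⟨Sum.elim x ![MvPolynomial.eval x R, 1], ⟨⟨?_, ?_⟩, fun i => ?_⟩, ?_⟩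
    · have e : (![(Sum.elim x ![MvPolynomial.eval x R, 1] : Fin 2 ⊕ Fin 2 → ℂ) (Sum.inl 0),
          (Sum.elim x ![MvPolynomial.eval x R, 1] : Fin 2 ⊕ Fin 2 → ℂ) (Sum.inl 1)] : Fin 2 → ℂ) =
          x := by
        funext j; fin_cases j <;> rfl
      rw [e]; exact hA
    · have e : (![(Sum.elim x ![MvPolynomial.eval x R, 1] : Fin 2 ⊕ Fin 2 → ℂ) (Sum.inl 0),
          (Sum.elim x ![MvPolynomial.eval x R, 1] : Fin 2 ⊕ Fin 2 → ℂ) (Sum.inl 1)] : Fin 2 → ℂ) =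
          x := by
        funext j; fin_cases j <;> rfl
      rw [e]; rfl
    · fin_cases i
      · simpa using hR
      · simp
    · funext j; simp

variable {A R}

/-- **`I(π(S(A; R) ∩ G²)) = (A)`** for irreducible `A` and `R` nonzero somewhere on `Z(A)`
(Nullstellensatz). (new) -/
theorem vanishingIdeal_projAdd_curveGraphFibre (hirr : Irreducible A)
    (hpt : ∃ x : Fin 2 → ℂ, MvPolynomial.eval x A = 0 ∧ MvPolynomial.eval x R ≠ 0) :
    vanishingIdeal ℂ (projAdd '' ({w : Fin 2 ⊕ Fin 2 → ℂ |
        MvPolynomial.eval ![w (Sum.inl 0), w (Sum.inl 1)] A = 0 ∧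
        w (Sum.inr 0) = MvPolynomial.eval ![w (Sum.inl 0), w (Sum.inl 1)] R} ∩ torusLocus ℂ 2)) =
      Ideal.span {A} := by
  have hprime : Prime A := UniqueFactorizationMonoid.irreducible_iff_prime.1 hirr
  haveI : (Ideal.span {A} : Ideal (MvPolynomial (Fin 2) ℂ)).IsPrime :=
    (Ideal.span_singleton_prime hprime.ne_zero).2 hprime
  rw [projAdd_image_curveGraphFibre_inter_torusLocus]
  refine le_antisymm ?_ ?_
  · intro g hg
    rw [mem_vanishingIdeal_iff] at hg
    -- `g R` vanishes on `Z(A)`, hence lies in `(A)`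
    have hgR : g * R ∈ vanishingIdeal ℂ (zeroLocus ℂ (Ideal.span {A} : Ideal (MvPolynomial (Fin 2) ℂ))) := by
      rw [mem_vanishingIdeal_iff]
      intro x hx
      have hAx : MvPolynomial.eval x A = 0 := by
        have h := (mem_zeroLocus_iff.1 hx) A (Ideal.mem_span_singleton_self A)
        rwa [MvPolynomial.aeval_eq_eval] at h
      rw [map_mul]
      by_cases hRx : MvPolynomial.eval x R = 0
      · rw [MvPolynomial.aeval_eq_eval, hRx, mul_zero]
      · have h := hg x ⟨hAx, hRx⟩
        rw [h, zero_mul]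
    rw [MvPolynomial.IsPrime.vanishingIdeal_zeroLocus, Ideal.mem_span_singleton] at hgR
    rcases hprime.dvd_or_dvd hgR with h | h
    · exact Ideal.mem_span_singleton.2 h
    · exfalso
      obtain ⟨x, hAx, hRx⟩ := hpt
      obtain ⟨c, hc⟩ := h
      apply hRx
      rw [hc, map_mul, hAx, zero_mul]
  · intro g hg
    rw [Ideal.mem_span_singleton] at hg
    obtain ⟨c, rfl⟩ := hg
    rw [mem_vanishingIdeal_iff]
    rintro x ⟨hAx, -⟩
    rw [map_mul, MvPolynomial.aeval_eq_eval, hAx, zero_mul]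

/-- **`dim cl π(S(A; R) ∩ G²) = 1`**: `ℂ[x₀, x₁]/(A)` has dimension `1`. (new) -/
theorem addProjDim_curveGraphFibre (hirr : Irreducible A)
    (hpt : ∃ x : Fin 2 → ℂ, MvPolynomial.eval x A = 0 ∧ MvPolynomial.eval x R ≠ 0) :
    addProjDim ℂ 2 {w : Fin 2 ⊕ Fin 2 → ℂ |
        MvPolynomial.eval ![w (Sum.inl 0), w (Sum.inl 1)] A = 0 ∧
        w (Sum.inr 0) = MvPolynomial.eval ![w (Sum.inl 0), w (Sum.inl 1)] R} = (1 : ℕ) := by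
  have hprime : Prime A := UniqueFactorizationMonoid.irreducible_iff_prime.1 hirr
  unfold addProjDim zariskiDim
  rw [vanishingIdeal_projAdd_curveGraphFibre hirr hpt,
    Literature.RingTheory.KrullDimension.ringKrullDim_quotient_span_of_prime_mvPolynomial hprime]

/-- **The closure of the base is not a line of rational slope**, given, for every `m ∈ ℤ² ∖ 0` and
`c`, a point of `Z(A)` off the line `m₀x₀ + m₁x₁ = c`. (new) -/
theorem not_isRationalSlopeLine_curveGraphFibre (hirr : Irreducible A)
    (hpt : ∃ x : Fin 2 → ℂ, MvPolynomial.eval x A = 0 ∧ MvPolynomial.eval x R ≠ 0)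
    (hline : ∀ m : Fin 2 → ℤ, m ≠ 0 → ∀ c : ℂ, ∃ x : Fin 2 → ℂ,
      MvPolynomial.eval x A = 0 ∧ (m 0 : ℂ) * x 0 + (m 1 : ℂ) * x 1 ≠ c) :
    ¬ IsRationalSlopeLine (zeroLocus ℂ (vanishingIdeal ℂ
      (projAdd '' ({w : Fin 2 ⊕ Fin 2 → ℂ |
        MvPolynomial.eval ![w (Sum.inl 0), w (Sum.inl 1)] A = 0 ∧
        w (Sum.inr 0) = MvPolynomial.eval ![w (Sum.inl 0), w (Sum.inl 1)] R} ∩ torusLocus ℂ 2)))) := by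
  rw [vanishingIdeal_projAdd_curveGraphFibre hirr hpt]
  rintro ⟨m, hm, c, hL⟩
  obtain ⟨x, hAx, hx⟩ := hline m hm c
  have hxZ : x ∈ zeroLocus ℂ (Ideal.span {A} : Ideal (MvPolynomial (Fin 2) ℂ)) := by
    rw [mem_zeroLocus_iff]
    intro p hp
    rw [Ideal.mem_span_singleton] at hp
    obtain ⟨q, rfl⟩ := hp
    rw [map_mul, MvPolynomial.aeval_eq_eval, hAx, zero_mul]
  rw [hL] at hxZ
  exact hx hxZ

/-- **Case certificate for graph fibres over an arbitrary plane curve.**  `A` irreducible, a point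
of `Z(A)` with `R ≠ 0`, and `Z(A)` not contained in a line of rational slope (witnesses as in
`not_isRationalSlopeLine_curveGraphFibre`): `S(A; R)` satisfies the hypotheses of Mantova–Masser's
case (dim-π-S-1-free). (new) -/
theorem mmCase_curveGraphFibre (hirr : Irreducible A)
    (hpt : ∃ x : Fin 2 → ℂ, MvPolynomial.eval x A = 0 ∧ MvPolynomial.eval x R ≠ 0)
    (hline : ∀ m : Fin 2 → ℤ, m ≠ 0 → ∀ c : ℂ, ∃ x : Fin 2 → ℂ,
      MvPolynomial.eval x A = 0 ∧ (m 0 : ℂ) * x 0 + (m 1 : ℂ) * x 1 ≠ c) :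
    MMCaseDimPiOneFree {w : Fin 2 ⊕ Fin 2 → ℂ |
        MvPolynomial.eval ![w (Sum.inl 0), w (Sum.inl 1)] A = 0 ∧
        w (Sum.inr 0) = MvPolynomial.eval ![w (Sum.inl 0), w (Sum.inl 1)] R} := by
  refine ⟨isIrreducibleClosed_curveGraphFibre R hirr, ?_, zariskiDim_curveGraphFibre R hirr,
    addProjDim_curveGraphFibre hirr hpt, not_isRationalSlopeLine_curveGraphFibre hirr hpt hline⟩
  obtain ⟨x, hAx, hRx⟩ := hpt
  have hmem : x ∈ projAdd '' ({w : Fin 2 ⊕ Fin 2 → ℂ |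
        MvPolynomial.eval ![w (Sum.inl 0), w (Sum.inl 1)] A = 0 ∧
        w (Sum.inr 0) = MvPolynomial.eval ![w (Sum.inl 0), w (Sum.inl 1)] R} ∩ torusLocus ℂ 2) := by
    rw [projAdd_image_curveGraphFibre_inter_torusLocus]
    exact ⟨hAx, hRx⟩
  obtain ⟨w, hw, -⟩ := hmem
  exact ⟨w, hw⟩

end Case

end Summit.Schanuel.Schanuel.Theorems
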